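import Mathlib
import Literature.Algebra.Polynomial.LacunaryBivariateOnLine
import Literature.Algebra.Polynomial.DescartesSignVariations
import Summits.ValiantsHypothesis.ValiantsHypothesis.Theorems.LacunarySymmetroidMatrixDescartesCensusLaguerreSum
import Summits.ValiantsHypothesis.ValiantsHypothesis.Theorems.LacunarySymmetroidMatrixDescartesCensusTwistedRolleMult
import Summits.ValiantsHypothesis.ValiantsHypothesis.Theorems.LacunarySymmetroidMatrixDescartesLocalMultiplicity
import Summits.ValiantsHypothesis.ValiantsHypothesis.Theorems.LacunarySymmetroidMatrixDescartesDegreeCeiling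
import Summits.ValiantsHypothesis.ValiantsHypothesis.Theorems.KPlusLogSqLawWeakLiftingTowerGraftRankOneGraft

/-!
# Tower graft line — T1 AT LINEAR STEEPNESS IN DESCARTES CURRENCY: every phantom is a non-real root of a digit

Mechanism file for the line `Cruxes/WeakLifting/Lines/tower_graft.lean` (crux `WeakLifting` = stmt-ValiantsHypothesis-19561;
S4b `stub_graftLawCorner`, memo `Lines/tower_graft-S5.md` §3 T1/T2).  NO stub is claimed.  Companion of
`…TowerGraftCornerPhantoms.lean` (this seat): there, at `m = 2`, the corner graft `h = A + X^D·E` (`A = det G`, `E = det G₀₀`) was shown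
to carry `2K − 3` positive zeros with `Z₊(A) = Z₊(E) = 0` at EVERY steepness — no additive law in instance currency.  HERE, the
complementary UPPER bound AT THE LINE'S OWN THRESHOLD `D > deg A` («lin»), with no disc geometry and no clearance hypothesis:

* the seam inequality `V(A + X^D·E) ≤ V(A) + V(E) + 1` for `natDegree A < D` is the tree's
  `Census.signVariations_add_X_pow_mul_le` (`…CensusLaguerreSum.lean`), cited not restated; `Z₊ ≤ pos` is the tree's
  `Census.card_posRoots_le_countP_posRoots`, `V ≤ #support − 1` the tree's `LocalMultiplicity.signVariations_le_card_support_sub_one`.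
* `signVariations_add_countP_nonpos_le_natDegree` — `V(P) + #{roots ≤ 0 of P, with multiplicity} ≤ natDegree P`, i.e.
  `V(P) ≤ pos(P) + nonreal(P)` with `pos` = positive roots with multiplicity and `nonreal(P) = natDegree P − #real roots`
  (Avendaño's Lemma 5 `V((X + r)·Q) ≤ V(Q)`, tree `Literature…signVariations_X_add_C_mul_le`, peeled root by root); hence
  **Descartes' rule is EXACT for hyperbolic polynomials** (`signVariations_eq_countP_pos_of_card_roots_eq`). [folklore]
* `card_posRoots_add_X_pow_mul_le_lin` — **T1 AT lin (kernel, Descartes form)**: for `natDegree A < D`,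
  `Z₊(A + X^D·E) ≤ V(A) + V(E) + 1 ≤ [pos(A) + nonreal(A)] + [pos(E) + nonreal(E)] + 1`:
  at tower steepness EVERY PHANTOM IS PAID BY A NON-REAL ROOT OF A DIGIT — all of them, wherever they lie (the disc instruments
  `…ClusterDiscs` / `…RootSumDiscs` / `…SharpCount` charge only NEAR-AXIS roots but need clearance / steeper `D`; this bound needs
  nothing but `D > deg A`).  `CornerPhantoms` shows the non-real term cannot be dropped: there `nonreal(A) ≥ 2K − 4` is forced.
* `card_posRoots_add_X_pow_mul_le_of_hyperbolic` — **THE ADDITIVE CORNER LAW HOLDS FOR HYPERBOLIC DIGITS** at every `D > deg A`: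
  `Z₊(A + X^D·E) ≤ pos(A) + pos(E) + 1` when `A` and `E` are real-rooted.

READING for S4b/T2: at `D = lin` the open object is exactly `nonreal(det G) + nonreal(det G₀₀)` RESTRICTED to what a sign-variation count
sees; in class currency T2 must bound the chargeable part by `O(B)`.  HONEST FRAMING: Descartes bookkeeping; nothing on S4/S4b/S5/S5ᴸ,
TowerB, `WeakLifting`, Conjecture B, `MatrixDescartes` (18050) or `VP ≠ VNP`.  Def-free.
Seat: prover val-sym-lift-p2 g19, `--supports stmt-ValiantsHypothesis-19561`.
-/

-- `Summit.ValiantsHypothesis.ValiantsHypothesis.…` repeats a component by the D-0017 layout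
-- (single-conjunct summit), which the `dupNamespace` linter flags; the name is mandated.
set_option linter.dupNamespace false

namespace Summit.ValiantsHypothesis.ValiantsHypothesis.Theorems.KPlusLogSqLaw.TowerGraft

open Polynomial
open Literature.Algebra.Polynomial (signVariations_X_add_C_mul_le)
open Literature.Algebra.Polynomial.Descartes (signVariations_X_pow_mul)
open Summit.ValiantsHypothesis.ValiantsHypothesis.Theorems.LacunarySymmetroidMatrixDescartes.Census
  (signVariations_add_X_pow_mul_le card_posRoots_le_countP_posRoots)
open Summit.ValiantsHypothesis.ValiantsHypothesis.Theorems.LacunarySymmetroidMatrixDescartes.LocalMultiplicity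
  (signVariations_le_card_support_sub_one)

section LinDescartes

/-- `V(P) ≤ natDegree P` (from the tree's `V ≤ #support − 1` and `#support ≤ natDegree + 1`). [folklore] -/
theorem signVariations_le_natDegree (P : ℝ[X]) : P.signVariations ≤ P.natDegree := by
  have h1 := signVariations_le_card_support_sub_one P
  have h2 := card_supp_le_succ_natDegree P
  omega

/-- **`V(P) ≤ pos(P) + nonreal(P)`**: the sign-variation count plus the number of non-positive roots (with multiplicity) is at most
the degree (peel the roots `a ≤ 0`: `V((X − a)·Q) ≤ V(Q)` for `a < 0` by Avendaño's Lemma 5, `= V(Q)` for `a = 0`). [folklore] -/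
theorem signVariations_add_countP_nonpos_le_natDegree (P : ℝ[X]) :
    P.signVariations + P.roots.countP (fun t => t ≤ 0) ≤ P.natDegree := by
  induction hd : P.natDegree using Nat.strong_induction_on generalizing P with
  | _ N ih =>
    by_cases hP : P = 0
    · subst hP; simp
    by_cases hzero : P.roots.countP (fun t => t ≤ 0) = 0
    · rw [hzero, add_zero, ← hd]; exact signVariations_le_natDegree P
    obtain ⟨a, haP, ha⟩ := Multiset.countP_pos.mp (Nat.pos_of_ne_zero hzero)
    have hroot : P.IsRoot a := (mem_roots hP).mp haP
    set Q := P /ₘ (X - C a) with hQ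
    have hfac : (X - C a) * Q = P := mul_divByMonic_eq_iff_isRoot.mpr hroot
    have hQ0 : Q ≠ 0 := by rintro h; rw [h, mul_zero] at hfac; exact hP hfac.symm
    have hdegP : P.natDegree = Q.natDegree + 1 := by
      rw [← hfac, natDegree_mul (X_sub_C_ne_zero a) hQ0, natDegree_X_sub_C]; ring
    have hrootsP : P.roots = a ::ₘ Q.roots := by
      rw [← hfac, roots_mul (hfac.symm ▸ hP), roots_X_sub_C]; rfl
    have hcount : P.roots.countP (fun t => t ≤ 0) = Q.roots.countP (fun t => t ≤ 0) + 1 := by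
      rw [hrootsP, Multiset.countP_cons_of_pos (p := fun t : ℝ => t ≤ 0) Q.roots ha]
    have hV : P.signVariations ≤ Q.signVariations := by
      rcases ha.lt_or_eq with hlt | heq
      · have h1 : X - C a = X + C (-a) := by rw [C_neg, sub_eq_add_neg]
        rw [← hfac, h1]
        exact signVariations_X_add_C_mul_le (by linarith) Q
      · rw [← hfac, heq, C_0, sub_zero, ← pow_one (X : ℝ[X]), signVariations_X_pow_mul]
    have hIH := ih Q.natDegree (by omega) Q rfl
    omega

/-- `V(P) ≤ pos(P) + (natDegree P − #real roots)`, the same inequality in «non-real roots» form. [folklore] -/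
theorem signVariations_le_countP_pos_add_nonreal (P : ℝ[X]) :
    P.signVariations ≤ P.roots.countP (fun t => 0 < t) + (P.natDegree - P.roots.card) := by
  have h1 := signVariations_add_countP_nonpos_le_natDegree P
  have h2 : P.roots.card = P.roots.countP (fun t => 0 < t) + P.roots.countP (fun t => t ≤ 0) := by
    rw [Multiset.card_eq_countP_add_countP (fun t : ℝ => 0 < t)]
    congr 1
    exact Multiset.countP_congr rfl fun x _ => by simp [not_lt]
  have h3 := P.card_roots'
  omega

/-- **Descartes' rule of signs is EXACT for hyperbolic polynomials**: if all roots of `P` are real (`#roots = natDegree`), then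
`V(P) = pos(P)`. [folklore] -/
theorem signVariations_eq_countP_pos_of_card_roots_eq {P : ℝ[X]} (hP : P.roots.card = P.natDegree) :
    P.signVariations = P.roots.countP (fun t => 0 < t) := by
  have h1 := signVariations_le_countP_pos_add_nonreal P
  have h2 := P.roots_countP_pos_le_signVariations
  rw [hP, Nat.sub_self, add_zero] at h1
  exact le_antisymm h1 h2

/-- **T1 AT LINEAR STEEPNESS, DESCARTES FORM.**  For `natDegree A < D`:
`Z₊(A + X^D·E) ≤ V(A) + V(E) + 1`. [this work] -/
theorem card_posRoots_add_X_pow_mul_le_signVariations {A : ℝ[X]} {D : ℕ} (hA : A.natDegree < D) (E : ℝ[X]) :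
    ((A + X ^ D * E).roots.toFinset.filter (fun t => 0 < t)).card ≤ A.signVariations + E.signVariations + 1 :=
  (card_posRoots_le_countP_posRoots _).trans
    ((roots_countP_pos_le_signVariations _).trans (signVariations_add_X_pow_mul_le A E hA))

/-- **T1 AT LINEAR STEEPNESS: EVERY PHANTOM IS A NON-REAL ROOT OF A DIGIT.**  For `natDegree A < D`:
`Z₊(A + X^D·E) ≤ [pos(A) + nonreal(A)] + [pos(E) + nonreal(E)] + 1`, `pos` = positive roots with multiplicity,
`nonreal(P) = natDegree P − #real roots of P` (with multiplicity). [this work] -/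
theorem card_posRoots_add_X_pow_mul_le_lin {A : ℝ[X]} {D : ℕ} (hA : A.natDegree < D) (E : ℝ[X]) :
    ((A + X ^ D * E).roots.toFinset.filter (fun t => 0 < t)).card ≤
      (A.roots.countP (fun t => 0 < t) + (A.natDegree - A.roots.card)) +
        (E.roots.countP (fun t => 0 < t) + (E.natDegree - E.roots.card)) + 1 :=
  (card_posRoots_add_X_pow_mul_le_signVariations hA E).trans
    (by have h1 := signVariations_le_countP_pos_add_nonreal A
        have h2 := signVariations_le_countP_pos_add_nonreal E
        omega)

/-- **THE ADDITIVE CORNER LAW HOLDS FOR HYPERBOLIC DIGITS, at every steepness `D > deg A`.**  If all roots of `A` and of `E` are real,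
`Z₊(A + X^D·E) ≤ pos(A) + pos(E) + 1`. [this work] -/
theorem card_posRoots_add_X_pow_mul_le_of_hyperbolic {A E : ℝ[X]} {D : ℕ} (hA : A.natDegree < D)
    (hAr : A.roots.card = A.natDegree) (hEr : E.roots.card = E.natDegree) :
    ((A + X ^ D * E).roots.toFinset.filter (fun t => 0 < t)).card ≤
      A.roots.countP (fun t => 0 < t) + E.roots.countP (fun t => 0 < t) + 1 := by
  have h := card_posRoots_add_X_pow_mul_le_signVariations hA E
  rwa [signVariations_eq_countP_pos_of_card_roots_eq hAr, signVariations_eq_countP_pos_of_card_roots_eq hEr] at h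

/-- **THE CORNER GRAFT AT TOWER-TOP STEEPNESS, DESCARTES FORM.**  For letters `Sₗ` of size `m + 1` on a support `d` with
`(m+1)·dₗ < D` for all `l` (the line's graft hypothesis), the corner graft `det (G + X^D·E₀₀) = det G + X^D·det G₀₀` has
`Z₊ ≤ V(det G) + V(det G₀₀) + 1` (and hence `≤ [pos + nonreal](det G) + [pos + nonreal](det G₀₀) + 1`). [this work] -/
theorem card_posRoots_cornerGraft_le_lin {m K D : ℕ} (hK : 0 < K) (d : Fin K → ℕ) (hD : ∀ l, (m + 1) * d l < D)
    (S : Fin K → Matrix (Fin (m + 1)) (Fin (m + 1)) ℝ) :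
    ((((∑ l, ((X : ℝ[X]) ^ d l) • (S l).map C) +
          (X : ℝ[X]) ^ D • Matrix.single (0 : Fin (m + 1)) (0 : Fin (m + 1)) (1 : ℝ[X])).det).roots.toFinset.filter
        (fun t => 0 < t)).card ≤
      (∑ l, ((X : ℝ[X]) ^ d l) • (S l).map C).det.signVariations +
        ((∑ l, ((X : ℝ[X]) ^ d l) • (S l).map C).submatrix Fin.succ Fin.succ).det.signVariations + 1 := by
  classical
  set G := ∑ l, ((X : ℝ[X]) ^ d l) • (S l).map C with hG
  have hdet : (G + (X : ℝ[X]) ^ D • Matrix.single (0 : Fin (m + 1)) (0 : Fin (m + 1)) (1 : ℝ[X])).det =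
      G.det + (X : ℝ[X]) ^ D * (G.submatrix Fin.succ Fin.succ).det :=
    det_add_smul_single_zero G ((X : ℝ[X]) ^ D)
  rw [hdet]
  refine card_posRoots_add_X_pow_mul_le_signVariations ?_ _
  -- `natDegree (det G) ≤ (m+1)·max d < D`
  obtain ⟨l₀, -, hl₀⟩ := Finset.exists_max_image Finset.univ d ⟨⟨0, hK⟩, Finset.mem_univ _⟩
  have h1 := Summit.ValiantsHypothesis.ValiantsHypothesis.Theorems.LacunarySymmetroidMatrixDescartes.DegreeCeiling.natDegree_det_pencil_le
    d S (d l₀) (fun l => hl₀ l (Finset.mem_univ l))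
  exact lt_of_le_of_lt h1 (hD l₀)

end LinDescartes

end Summit.ValiantsHypothesis.ValiantsHypothesis.Theorems.KPlusLogSqLaw.TowerGraft
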